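/-
Copyright (c) 2026 the pub-hodgecm-mathlib formalisation cell (harness21).  Prover seat hodgecm-mathlib-F0P3-p02 (g26), 2026-09-03.  E1 row 33 «HECKE IDEMPOTENTS OF
MUTUALLY NORMALISING LEVELS COMPOSE» (E1 keeper ∕ dealer F0P3a-p03 (g29) 01:07:52Z; census «E1 ∕ KAZHDAN-IN-HOUSE» v1 §2-K1 (R)).
-/
import Literature.NumberTheory.Automorphic.CompactOpenAveraging   -- ★ `Representation.avgProj`, `avgProj_eq`, `apply_avgProj`, `avgProj_add`, `avgProj_smul`, `avgProj_apply_of_mem`; `IsLeftTransversal`, `exists_isLeftTransversal`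
import HarnessLib

/-!
# Composition of the averaging projectors `e_K` of compact subgroups: the product rule `e_{H·P} v = e_H v`, `e_{K₁} e_{K₂} = e_{K₁K₂} = e_{K₂} e_{K₁}`
# for a product group, the mutually-normalising package, and the geodesic collapse `e_x e_y w = e_x w` for `U_y ⊆ U_x U_z`, `w ∈ V^{U_z}`

Topic `NumberTheory/Automorphic`; declarations in the `Representation` namespace, dot-style next to ★ `Representation.avgProj` of
★ `Literature.NumberTheory.Automorphic.CompactOpenAveraging` (as ★ `JacquetRayHeckeOperator` does).  THEOREMS ONLY (no definition, no instance,
no notation, no named fact, no `sorry`).  Cell `pub/hodgecm-mathlib` (D-0151), crux H413 = `stmt-HodgeConjecture-24833`, lane `--supports`; E1 BRICK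
LEDGER row 33 (keeper F0P3a-p03 (g29) 01:07:52Z: «the projector identities `e_{U_x} e_{U_y} = e_{U_F} = e_{U_y} e_{U_x}` that Schneider–Stuhler's contraction
[SS97 II.3] runs on; for compact `K₁ K₂ ≤ G` with `K₁ ≤ N(K₂)` (so `↑(K₁ ⊔ K₂) = ↑K₁ * ↑K₂` and `K₁ ⊔ K₂` is compact): (i) `e_{K₁} (e_{K₂} v) = e_{K₁ ⊔ K₂} v`
for `v` smooth; (ii) the other order, hence COMMUTE; (iii) `e_{K₁ ⊔ K₂} v ∈ V^{K₁} ⊓ V^{K₂}`»).  HONEST LABEL: count-neutral generic base layer of the (R-SS)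
resolution engine; HC_CM is proved only modulo the 2 remaining named inputs (hLiu418 = `stmt-HodgeConjecture-24832`, h413 = `stmt-HodgeConjecture-24833`)
until rung 0 closes; nothing printed is asserted here — these are finite-sum identities over transversals.

SETTING.  `k` a field of characteristic `0`, `G` a topological group, `ρ : Representation k G V` (NOT assumed smooth: every statement carries
`ρ.IsSmoothVector v` for the vectors it averages), `K, H, P, K₁, K₂, Kx, Ky, Kz ≤ G` subgroups with `IsCompact (K : Set G)` where averaged over.
`e_K v = ρ.avgProj K v = #R⁻¹ • Σ_{r ∈ R} ρ(r) v` for any transversal `R` of `K ∕ (K ∩ T)`, `T` open fixing `v` (★ `avgProj_eq`).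

* §0 BOOKKEEPING: `e_K v` is smooth (`isSmoothVector_avgProj`) and `K`-fixed (`avgProj_mem_fixedPoints`); `e_K v = v` for `v ∈ V^K` smooth WITHOUT `K`
  open (`avgProj_of_mem_fixedPoints`; ★ `avgProj_of_forall_apply_eq` wants `K` open); idempotence `e_K e_K = e_K` (`avgProj_avgProj_self`); linearity over a
  `Finset` sum of smooth vectors (`avgProj_finset_sum`).
* §1 THE PRODUCT RULE: if `↑K = ↑H * ↑P` as sets and `P` fixes `v`, a transversal of `H ∕ H ∩ Stab(v)` is a transversal of `K ∕ K ∩ Stab(v)`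
  (`isLeftTransversal_of_coe_eq_mul`), hence **`e_K v = e_H v`** (`avgProj_eq_avgProj_of_coe_eq_mul`; mirror `…'` for `↑K = ↑P * ↑H`).  This is the
  `avgProj` twin of ★ `SmoothProjector.avg_eq_avg_of_coe_eq_mul` (orbit-average currency) and the general form of ★ `avgProj_eq_avgProj_inf_N`
  (Iwahori-factorised `K = (K∩N̄)(K∩M)(K∩N)`).
* §2 COMPOSITION FOR A PRODUCT GROUP: `↑K = ↑K₁ * ↑K₂` (all three compact) ⇒ **`e_{K₁} (e_{K₂} v) = e_K v`** (`avgProj_avgProj_eq_avgProj_of_coe_eq_mul`) and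
  `e_{K₂} (e_{K₁} v) = e_K v` (`…'`, through `(K₁K₂)⁻¹ = K₂K₁`); with `K = K₁ ⊔ K₂` (compactness DERIVED by `IsCompact.mul`):
  `avgProj_avgProj_eq_avgProj_sup`, `avgProj_avgProj_eq_avgProj_sup'`, COMMUTATION `avgProj_avgProj_comm_of_coe_sup_eq_mul`.
* §3 THE MUTUALLY-NORMALISING PACKAGE (`K₁ ≤ K₂.normalizer`, Mathlib `Subgroup.coe_mul_of_left_le_normalizer_right`): `isCompact_coe_sup_of_le_normalizer`,
  **(i) `avgProj_avgProj_eq_avgProj_sup_of_le_normalizer`**, (ii) `…'` + `avgProj_avgProj_comm_of_le_normalizer`, (iii) `avgProj_sup_mem_fixedPoints_inf`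
  (`e_{K₁ ⊔ K₂} v ∈ V^{K₁} ⊓ V^{K₂}`, which is `V^{K₁ ⊔ K₂}` by ★ row 28 `Literature.NumberTheory.Automorphic.fixedPoints_sup` — cited, not imported) and
  `avgProj_avgProj_mem_fixedPoints_inf`.  INSTANCE POINTER (hypothesis style, no lattice import): for the Schneider–Stuhler EDGE group `U_F = U_M ⊔ U_{M′}`
  of the lattice tree ★ row 22b `UnitaryLatticeTree.levelSubgroup_le_normalizer_of_edge` supplies `hle` and ★ `sup_levelSubgroup_eq_of_mem_iff_exists_mul` ∕
  `coe_sup_levelSubgroup_eq_mul_of_edge` supply `hmul` [SS97 I.2 (U6)].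
* §4 THE GEODESIC COLLAPSE ((U7) form [SS97 I.2]): `↑Ky ⊆ ↑Kx * ↑Kz` and `w ∈ V^{Kz}` smooth ⇒ **`e_{Kx} (e_{Ky} w) = e_{Kx} w`**
  (`avgProj_avgProj_eq_avgProj_of_subset_mul`): every `ρ(r) w`, `r = a b ∈ Ky`, is `ρ(a) w` with `a ∈ Kx`, which `e_{Kx}` averages away.

## References
* [BernsteinZelevinsky1976] I. N. Bernstein, A. V. Zelevinsky, *Representations of the group `GL(n,F)` where `F` is a non-archimedean local field*, Russian
  Math. Surveys 31:3 (1976), §2.3 (the idempotents `e_K` of the Hecke algebra, `π(e_K)`).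
* [Casselman1995] W. Casselman, *Introduction to the theory of admissible representations of `p`-adic reductive groups* (1995 notes), §2.1 (the projection
  `P_K`), Thm. 3.3.4 (the factorised case).
* [SchneiderStuhler1997] P. Schneider, U. Stuhler, *Representation theory and sheaves on the Bruhat–Tits building*, Publ. Math. IHÉS 85 (1997): Cor. I.2.9 p. 114
  (the `U_F^{(e)}` are compact open), Prop. I.2.11 (ii) p. 116 (`U_F^{(e)} = Π_{x ∈ F̄} U_x^{(e)}`), Prop. I.3.1 ∕ I.3.2 pp. 118–119 (`U_z^{(e)} ⊆ U_x^{(e)} U_y^{(e)}` for `z ∈ [x,y]`),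
  Ch. II §3 p. 123 (homological resolutions: the contraction of the coefficient system `F ↦ V^{U_F^{(e)}}`, which composes exactly these idempotents).
* [Korman2004] J. Korman, *A character formula for compact elements (the rank one case)*, arXiv:math/0409292: §3.6 (the labels (U1)–(U7) for the [SS97] properties used
  in the docstrings below).
-/

set_option autoImplicit false

open scoped BigOperators Pointwise
open Literature.NumberTheory.Automorphic

namespace Representation

variable {k G V : Type*} [Field k] [CharZero k] [Group G] [TopologicalSpace G] [IsTopologicalGroup G]
  [AddCommGroup V] [Module k V] {ρ : Representation k G V}

/-! ## §0 Bookkeeping: smoothness, fixedness and idempotence of `e_K v` -/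

omit [CharZero k] in
/-- A `Finset` sum of smooth vectors is smooth (the smooth part `V^∞` is a subspace). [cite: BernsteinZelevinsky1976, §2.1] -/
theorem isSmoothVector_finset_sum {ι : Type*} (s : Finset ι) (f : ι → V) (hf : ∀ i ∈ s, ρ.IsSmoothVector (f i)) :
    ρ.IsSmoothVector (∑ i ∈ s, f i) := by
  classical
  induction s using Finset.induction_on with
  | empty => simpa using ρ.isSmoothVector_zero
  | insert a s ha ih =>
    rw [Finset.sum_insert ha]
    exact IsSmoothVector.add ρ (hf a (Finset.mem_insert_self a s)) (ih fun i hi => hf i (Finset.mem_insert_of_mem hi))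

omit [CharZero k] in
/-- A normalised finite sum of translates of a smooth vector is smooth (the smooth part `V^∞` is a `G`-stable subspace). [cite: BernsteinZelevinsky1976, §2.1] -/
theorem isSmoothVector_inv_card_smul_sum (R : Finset G) {v : V} (hv : ρ.IsSmoothVector v) :
    ρ.IsSmoothVector ((R.card : k)⁻¹ • ∑ r ∈ R, ρ r v) :=
  IsSmoothVector.smul ρ _ (isSmoothVector_finset_sum R _ fun r _ => IsSmoothVector.apply ρ r hv)

/-- **`e_K v` is smooth** for `K` compact and `v` smooth. [cite: BernsteinZelevinsky1976, §2.3] -/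
theorem isSmoothVector_avgProj {K : Subgroup G} (hK : IsCompact (K : Set G)) {v : V} (hv : ρ.IsSmoothVector v) :
    ρ.IsSmoothVector (ρ.avgProj K v) := by
  obtain ⟨R, hR⟩ := exists_isLeftTransversal (B := K) hK hv
  rw [avgProj_eq hK hv (fun t ht => (ρ.mem_stabilizerSubgroup v t).1 ht) hR]
  exact isSmoothVector_inv_card_smul_sum R hv

/-- **`e_K v ∈ V^K`** for `K` compact and `v` smooth. [cite: BernsteinZelevinsky1976, §2.3] -/
theorem avgProj_mem_fixedPoints {K : Subgroup G} (hK : IsCompact (K : Set G)) {v : V} (hv : ρ.IsSmoothVector v) :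
    ρ.avgProj K v ∈ ρ.fixedPoints K :=
  (ρ.mem_fixedPoints K _).2 fun _ hκ => apply_avgProj hK hv hκ

/-- **`e_K v = v` for `v ∈ V^K` smooth** (`K` compact, not necessarily open: the transversal of `K ∕ (K ∩ Stab v) = K ∕ K` is a single point).
[cite: Casselman1995, §2.1] -/
theorem avgProj_of_mem_fixedPoints {K : Subgroup G} (hK : IsCompact (K : Set G)) {v : V} (hv : ρ.IsSmoothVector v)
    (hfix : v ∈ ρ.fixedPoints K) : ρ.avgProj K v = v := by
  obtain ⟨R, hR⟩ := exists_isLeftTransversal (B := K) hK hv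
  rw [avgProj_eq hK hv (fun t ht => (ρ.mem_stabilizerSubgroup v t).1 ht) hR]
  have hfix' : ∀ κ ∈ K, ρ κ v = v := (ρ.mem_fixedPoints K v).1 hfix
  have : ∑ r ∈ R, ρ r v = R.card • v := by
    rw [← Finset.sum_const]
    exact Finset.sum_congr rfl fun r hr => hfix' r (hR.mem_of_mem r hr)
  rw [this, ← Nat.cast_smul_eq_nsmul k, smul_smul,
    inv_mul_cancel₀ (Nat.cast_ne_zero.2 (Finset.card_ne_zero.2 hR.nonempty)), one_smul]

/-- **Idempotence `e_K (e_K v) = e_K v`** for `K` compact and `v` smooth. [cite: BernsteinZelevinsky1976, §2.3] -/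
theorem avgProj_avgProj_self {K : Subgroup G} (hK : IsCompact (K : Set G)) {v : V} (hv : ρ.IsSmoothVector v) :
    ρ.avgProj K (ρ.avgProj K v) = ρ.avgProj K v :=
  avgProj_of_mem_fixedPoints hK (isSmoothVector_avgProj hK hv) (avgProj_mem_fixedPoints hK hv)

/-- `e_K` through a `Finset` sum of SMOOTH vectors (no global smoothness of `ρ` needed; cf. ★ `avgProj_sum_of_isSmooth`): `π(e_K)` is linear on `V^∞`.
[cite: BernsteinZelevinsky1976, §2.3] -/
theorem avgProj_finset_sum {K : Subgroup G} (hK : IsCompact (K : Set G)) {ι : Type*} (s : Finset ι) (f : ι → V)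
    (hf : ∀ i ∈ s, ρ.IsSmoothVector (f i)) : ρ.avgProj K (∑ i ∈ s, f i) = ∑ i ∈ s, ρ.avgProj K (f i) := by
  classical
  induction s using Finset.induction_on with
  | empty =>
    simp only [Finset.sum_empty]
    have h := avgProj_smul hK (0 : k) (ρ.isSmoothVector_zero)
    rwa [zero_smul, zero_smul] at h
  | insert a s ha ih =>
    have hfa : ρ.IsSmoothVector (f a) := hf a (Finset.mem_insert_self a s)
    have hfs : ∀ i ∈ s, ρ.IsSmoothVector (f i) := fun i hi => hf i (Finset.mem_insert_of_mem hi)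
    rw [Finset.sum_insert ha, Finset.sum_insert ha, avgProj_add hK hfa (isSmoothVector_finset_sum s f hfs), ih hfs]

/-- `e_K` through a normalised sum of translates: `e_K (#R⁻¹ • Σ_{r ∈ R} ρ(r) v) = #R⁻¹ • Σ_{r ∈ R} e_K (ρ(r) v)` for `v` smooth (`π(e_K)` is linear on `V^∞`).
[cite: BernsteinZelevinsky1976, §2.3] -/
theorem avgProj_inv_card_smul_sum {K : Subgroup G} (hK : IsCompact (K : Set G)) (R : Finset G) {v : V} (hv : ρ.IsSmoothVector v) :
    ρ.avgProj K ((R.card : k)⁻¹ • ∑ r ∈ R, ρ r v) = (R.card : k)⁻¹ • ∑ r ∈ R, ρ.avgProj K (ρ r v) := by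
  have hs : ρ.IsSmoothVector (∑ r ∈ R, ρ r v) := isSmoothVector_finset_sum R _ fun r _ => IsSmoothVector.apply ρ r hv
  rw [avgProj_smul hK _ hs, avgProj_finset_sum hK R _ (fun r _ => IsSmoothVector.apply ρ r hv)]

/-! ## §1 The product rule `e_{H·P} v = e_H v` when `P` fixes `v` -/

omit [CharZero k] [TopologicalSpace G] [IsTopologicalGroup G] in
/-- **A transversal of `H ∕ (H ∩ Stab v)` is a transversal of `K ∕ (K ∩ Stab v)` when `↑K = ↑H * ↑P` and `P` fixes `v`**: every `x = h p ∈ K` lies in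
the coset of the representative of `h`. [cite: Casselman1995, Thm. 3.3.4 p. 35] -/
theorem isLeftTransversal_of_coe_eq_mul {K H P : Subgroup G} (hKHP : (K : Set G) = (H : Set G) * (P : Set G)) {v : V}
    (hPv : ∀ p ∈ P, ρ p v = v) {R : Finset G} (hR : IsLeftTransversal H (H ⊓ ρ.stabilizerSubgroup v) R) :
    IsLeftTransversal K (K ⊓ ρ.stabilizerSubgroup v) R := by
  -- `H ≤ K` because `1 ∈ P`
  have hHK : ∀ h ∈ H, h ∈ K := fun h hh => by
    have : h * 1 ∈ (K : Set G) := by rw [hKHP]; exact Set.mul_mem_mul hh P.one_mem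
    simpa using this
  refine ⟨fun r hr => hHK r (hR.mem_of_mem r hr), fun x hx => ?_⟩
  have hx' : x ∈ (K : Set G) := hx
  rw [hKHP] at hx'
  obtain ⟨h, hh, p, hp, rfl⟩ := Set.mem_mul.1 hx'
  have hpS : p ∈ ρ.stabilizerSubgroup v := (ρ.mem_stabilizerSubgroup v p).2 (hPv p hp)
  obtain ⟨r, ⟨hrR, hr⟩, huniq⟩ := hR.existsUnique h hh
  refine ⟨r, ⟨hrR, Subgroup.mem_inf.2 ⟨K.mul_mem (K.inv_mem (hHK r (hR.mem_of_mem r hrR))) hx, ?_⟩⟩, fun r' hr' => huniq r' ⟨hr'.1, ?_⟩⟩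
  · have : r⁻¹ * (h * p) = (r⁻¹ * h) * p := by group
    rw [this]
    exact (ρ.stabilizerSubgroup v).mul_mem (Subgroup.mem_inf.1 hr).2 hpS
  · have hr'x : r'⁻¹ * (h * p) ∈ ρ.stabilizerSubgroup v := (Subgroup.mem_inf.1 hr'.2).2
    have hmem : r'⁻¹ * h ∈ ρ.stabilizerSubgroup v := by
      have : r'⁻¹ * h = (r'⁻¹ * (h * p)) * p⁻¹ := by group
      rw [this]
      exact (ρ.stabilizerSubgroup v).mul_mem hr'x ((ρ.stabilizerSubgroup v).inv_mem hpS)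
    exact Subgroup.mem_inf.2 ⟨H.mul_mem (H.inv_mem (hR.mem_of_mem r' hr'.1)) hh, hmem⟩

/-- **THE PRODUCT RULE `e_K v = e_H v`** for `↑K = ↑H * ↑P` (as sets; `K, H` compact), `v` smooth and fixed by `P`: both sides are the same normalised sum over a
transversal of `H ∕ (H ∩ Stab v)`.  The `avgProj` twin of ★ `SmoothProjector.avg_eq_avg_of_coe_eq_mul`; ★ `avgProj_eq_avgProj_inf_N` is the factorised case.
[cite: Casselman1995, Thm. 3.3.4 p. 35] [cite: BernsteinZelevinsky1976, §2.3] -/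
theorem avgProj_eq_avgProj_of_coe_eq_mul {K H P : Subgroup G} (hK : IsCompact (K : Set G)) (hH : IsCompact (H : Set G))
    (hKHP : (K : Set G) = (H : Set G) * (P : Set G)) {v : V} (hv : ρ.IsSmoothVector v) (hPv : ∀ p ∈ P, ρ p v = v) :
    ρ.avgProj K v = ρ.avgProj H v := by
  obtain ⟨R, hR⟩ := exists_isLeftTransversal (B := H) hH hv
  have hstab : ∀ s ∈ ρ.stabilizerSubgroup v, ρ s v = v := fun s hs => (ρ.mem_stabilizerSubgroup v s).1 hs
  rw [avgProj_eq hH hv hstab hR, avgProj_eq hK hv hstab (isLeftTransversal_of_coe_eq_mul hKHP hPv hR)]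

/-- **THE PRODUCT RULE, mirrored: `e_K v = e_H v` for `↑K = ↑P * ↑H`**, `P` fixing `v`. [cite: Casselman1995, Thm. 3.3.4 p. 35] -/
theorem avgProj_eq_avgProj_of_coe_eq_mul' {K H P : Subgroup G} (hK : IsCompact (K : Set G)) (hH : IsCompact (H : Set G))
    (hKPH : (K : Set G) = (P : Set G) * (H : Set G)) {v : V} (hv : ρ.IsSmoothVector v) (hPv : ∀ p ∈ P, ρ p v = v) :
    ρ.avgProj K v = ρ.avgProj H v := by
  -- `↑K = (↑K)⁻¹ = (↑P * ↑H)⁻¹ = ↑H * ↑P`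
  have hKHP : (K : Set G) = (H : Set G) * (P : Set G) := by
    rw [← inv_coe_set (H := K), hKPH, mul_inv_rev, inv_coe_set, inv_coe_set]
  exact avgProj_eq_avgProj_of_coe_eq_mul hK hH hKHP hv hPv

/-! ## §2 Composition for a product group `↑K = ↑K₁ * ↑K₂` -/

/-- `e_K (e_{K₂} v) = e_K v` whenever `K₂ ≤ K` (`K, K₂` compact, `v` smooth): the inner average is a normalised sum of `ρ(r) v`, `r ∈ K`, each of which
`e_K` sends to `e_K v`. [cite: BernsteinZelevinsky1976, §2.3] -/
theorem avgProj_avgProj_of_le {K K₂ : Subgroup G} (hK : IsCompact (K : Set G)) (hK₂ : IsCompact (K₂ : Set G)) (hle : K₂ ≤ K)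
    {v : V} (hv : ρ.IsSmoothVector v) : ρ.avgProj K (ρ.avgProj K₂ v) = ρ.avgProj K v := by
  obtain ⟨R, hR⟩ := exists_isLeftTransversal (B := K₂) hK₂ hv
  have hstab : ∀ s ∈ ρ.stabilizerSubgroup v, ρ s v = v := fun s hs => (ρ.mem_stabilizerSubgroup v s).1 hs
  rw [avgProj_eq hK₂ hv hstab hR, avgProj_inv_card_smul_sum hK R hv]
  have : ∑ r ∈ R, ρ.avgProj K (ρ r v) = R.card • ρ.avgProj K v := by
    rw [← Finset.sum_const]
    exact Finset.sum_congr rfl fun r hr => avgProj_apply_of_mem hK hv (hle (hR.mem_of_mem r hr))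
  rw [this, ← Nat.cast_smul_eq_nsmul k, smul_smul,
    inv_mul_cancel₀ (Nat.cast_ne_zero.2 (Finset.card_ne_zero.2 hR.nonempty)), one_smul]

/-- **COMPOSITION `e_{K₁} (e_{K₂} v) = e_K v` for a product group `↑K = ↑K₁ * ↑K₂`** (all compact, `v` smooth): `e_{K₂} v` is smooth and `K₂`-fixed, so the
product rule gives `e_K (e_{K₂} v) = e_{K₁} (e_{K₂} v)`, and `e_K e_{K₂} = e_K` since `K₂ ≤ K`. [cite: SchneiderStuhler1997, Prop. I.2.11 (ii) p. 116; Ch. II §3 p. 123] [cite: Korman2004, §3.6 (U6)]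
[cite: BernsteinZelevinsky1976, §2.3] -/
theorem avgProj_avgProj_eq_avgProj_of_coe_eq_mul {K K₁ K₂ : Subgroup G} (hK : IsCompact (K : Set G)) (hK₁ : IsCompact (K₁ : Set G))
    (hK₂ : IsCompact (K₂ : Set G)) (hmul : (K : Set G) = (K₁ : Set G) * (K₂ : Set G)) {v : V} (hv : ρ.IsSmoothVector v) :
    ρ.avgProj K₁ (ρ.avgProj K₂ v) = ρ.avgProj K v := by
  have hK₂K : K₂ ≤ K := fun x hx => by
    have : 1 * x ∈ (K : Set G) := by rw [hmul]; exact Set.mul_mem_mul K₁.one_mem hx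
    simpa using this
  have hw : ρ.IsSmoothVector (ρ.avgProj K₂ v) := isSmoothVector_avgProj hK₂ hv
  have hwfix : ∀ p ∈ K₂, ρ p (ρ.avgProj K₂ v) = ρ.avgProj K₂ v := fun p hp => apply_avgProj hK₂ hv hp
  rw [← avgProj_eq_avgProj_of_coe_eq_mul hK hK₁ hmul hw hwfix, avgProj_avgProj_of_le hK hK₂ hK₂K hv]

/-- **COMPOSITION, the other order: `e_{K₂} (e_{K₁} v) = e_K v` for `↑K = ↑K₁ * ↑K₂`** (through `↑K = ↑K₂ * ↑K₁`, inverting the set identity).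
[cite: SchneiderStuhler1997, Prop. I.2.11 (ii) p. 116; Ch. II §3 p. 123] [cite: Korman2004, §3.6 (U6)] -/
theorem avgProj_avgProj_eq_avgProj_of_coe_eq_mul' {K K₁ K₂ : Subgroup G} (hK : IsCompact (K : Set G)) (hK₁ : IsCompact (K₁ : Set G))
    (hK₂ : IsCompact (K₂ : Set G)) (hmul : (K : Set G) = (K₁ : Set G) * (K₂ : Set G)) {v : V} (hv : ρ.IsSmoothVector v) :
    ρ.avgProj K₂ (ρ.avgProj K₁ v) = ρ.avgProj K v := by
  have hmul' : (K : Set G) = (K₂ : Set G) * (K₁ : Set G) := by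
    rw [← inv_coe_set (H := K), hmul, mul_inv_rev, inv_coe_set, inv_coe_set]
  exact avgProj_avgProj_eq_avgProj_of_coe_eq_mul hK hK₂ hK₁ hmul' hv

/-- `K₁ ⊔ K₂` is compact when `↑(K₁ ⊔ K₂) = ↑K₁ * ↑K₂` with `K₁, K₂` compact (continuous image of `K₁ × K₂`; the facet groups `U_F^{(e)} = Π_x U_x^{(e)}` are
compact open). [cite: SchneiderStuhler1997, Cor. I.2.9 p. 114, Prop. I.2.11 (ii) p. 116] [cite: Korman2004, §3.6 (U1) (U6)] -/
theorem isCompact_coe_sup_of_coe_sup_eq_mul {K₁ K₂ : Subgroup G} (hK₁ : IsCompact (K₁ : Set G)) (hK₂ : IsCompact (K₂ : Set G))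
    (hmul : ((K₁ ⊔ K₂ : Subgroup G) : Set G) = (K₁ : Set G) * (K₂ : Set G)) : IsCompact ((K₁ ⊔ K₂ : Subgroup G) : Set G) := by
  rw [hmul]
  exact hK₁.mul hK₂

/-- **(i) `e_{K₁} (e_{K₂} v) = e_{K₁ ⊔ K₂} v`** when `↑(K₁ ⊔ K₂) = ↑K₁ * ↑K₂` (`K₁, K₂` compact, `v` smooth; compactness of `K₁ ⊔ K₂` is derived).
[cite: SchneiderStuhler1997, Prop. I.2.11 (ii) p. 116; Ch. II §3 p. 123] [cite: Korman2004, §3.6 (U6)] [cite: BernsteinZelevinsky1976, §2.3] -/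
theorem avgProj_avgProj_eq_avgProj_sup {K₁ K₂ : Subgroup G} (hK₁ : IsCompact (K₁ : Set G)) (hK₂ : IsCompact (K₂ : Set G))
    (hmul : ((K₁ ⊔ K₂ : Subgroup G) : Set G) = (K₁ : Set G) * (K₂ : Set G)) {v : V} (hv : ρ.IsSmoothVector v) :
    ρ.avgProj K₁ (ρ.avgProj K₂ v) = ρ.avgProj (K₁ ⊔ K₂) v :=
  avgProj_avgProj_eq_avgProj_of_coe_eq_mul (isCompact_coe_sup_of_coe_sup_eq_mul hK₁ hK₂ hmul) hK₁ hK₂ hmul hv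

/-- **(ii) `e_{K₂} (e_{K₁} v) = e_{K₁ ⊔ K₂} v`** when `↑(K₁ ⊔ K₂) = ↑K₁ * ↑K₂`. [cite: SchneiderStuhler1997, Prop. I.2.11 (ii) p. 116; Ch. II §3 p. 123] [cite: Korman2004, §3.6 (U6)] -/
theorem avgProj_avgProj_eq_avgProj_sup' {K₁ K₂ : Subgroup G} (hK₁ : IsCompact (K₁ : Set G)) (hK₂ : IsCompact (K₂ : Set G))
    (hmul : ((K₁ ⊔ K₂ : Subgroup G) : Set G) = (K₁ : Set G) * (K₂ : Set G)) {v : V} (hv : ρ.IsSmoothVector v) :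
    ρ.avgProj K₂ (ρ.avgProj K₁ v) = ρ.avgProj (K₁ ⊔ K₂) v :=
  avgProj_avgProj_eq_avgProj_of_coe_eq_mul' (isCompact_coe_sup_of_coe_sup_eq_mul hK₁ hK₂ hmul) hK₁ hK₂ hmul hv

/-- **(ii) COMMUTATION `e_{K₁} e_{K₂} = e_{K₂} e_{K₁}`** on smooth vectors when `↑(K₁ ⊔ K₂) = ↑K₁ * ↑K₂`. [cite: SchneiderStuhler1997, Ch. II §3 p. 123] -/
theorem avgProj_avgProj_comm_of_coe_sup_eq_mul {K₁ K₂ : Subgroup G} (hK₁ : IsCompact (K₁ : Set G)) (hK₂ : IsCompact (K₂ : Set G))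
    (hmul : ((K₁ ⊔ K₂ : Subgroup G) : Set G) = (K₁ : Set G) * (K₂ : Set G)) {v : V} (hv : ρ.IsSmoothVector v) :
    ρ.avgProj K₁ (ρ.avgProj K₂ v) = ρ.avgProj K₂ (ρ.avgProj K₁ v) := by
  rw [avgProj_avgProj_eq_avgProj_sup hK₁ hK₂ hmul hv, avgProj_avgProj_eq_avgProj_sup' hK₁ hK₂ hmul hv]

/-! ## §3 The mutually-normalising package `K₁ ≤ N(K₂)` -/

/-- `K₁ ⊔ K₂` is compact for compact `K₁ ≤ N(K₂)`, `K₂` (its carrier is `↑K₁ * ↑K₂`, Mathlib `Subgroup.coe_mul_of_left_le_normalizer_right`; the facet groups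
`U_F^{(e)} = Π_x U_x^{(e)}` are compact open). [cite: SchneiderStuhler1997, Cor. I.2.9 p. 114, Prop. I.2.11 (ii) p. 116] [cite: Korman2004, §3.6 (U1) (U6)] -/
theorem isCompact_coe_sup_of_le_normalizer {K₁ K₂ : Subgroup G} (hK₁ : IsCompact (K₁ : Set G)) (hK₂ : IsCompact (K₂ : Set G))
    (hle : K₁ ≤ Subgroup.normalizer (K₂ : Set G)) : IsCompact ((K₁ ⊔ K₂ : Subgroup G) : Set G) :=
  isCompact_coe_sup_of_coe_sup_eq_mul hK₁ hK₂ (Subgroup.coe_mul_of_left_le_normalizer_right K₁ K₂ hle)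

/-- **(i) `e_{K₁} (e_{K₂} v) = e_{K₁ ⊔ K₂} v` for compact `K₁ ≤ N(K₂)`, `K₂` and `v` smooth.** [cite: SchneiderStuhler1997, Prop. I.2.11 (ii) p. 116; Ch. II §3 p. 123] [cite: Korman2004, §3.6 (U6)]
[cite: BernsteinZelevinsky1976, §2.3] -/
theorem avgProj_avgProj_eq_avgProj_sup_of_le_normalizer {K₁ K₂ : Subgroup G} (hK₁ : IsCompact (K₁ : Set G)) (hK₂ : IsCompact (K₂ : Set G))
    (hle : K₁ ≤ Subgroup.normalizer (K₂ : Set G)) {v : V} (hv : ρ.IsSmoothVector v) :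
    ρ.avgProj K₁ (ρ.avgProj K₂ v) = ρ.avgProj (K₁ ⊔ K₂) v :=
  avgProj_avgProj_eq_avgProj_sup hK₁ hK₂ (Subgroup.coe_mul_of_left_le_normalizer_right K₁ K₂ hle) hv

/-- **(ii) `e_{K₂} (e_{K₁} v) = e_{K₁ ⊔ K₂} v` for compact `K₁ ≤ N(K₂)`, `K₂`.** [cite: SchneiderStuhler1997, Prop. I.2.11 (ii) p. 116; Ch. II §3 p. 123] [cite: Korman2004, §3.6 (U6)] -/
theorem avgProj_avgProj_eq_avgProj_sup_of_le_normalizer' {K₁ K₂ : Subgroup G} (hK₁ : IsCompact (K₁ : Set G)) (hK₂ : IsCompact (K₂ : Set G))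
    (hle : K₁ ≤ Subgroup.normalizer (K₂ : Set G)) {v : V} (hv : ρ.IsSmoothVector v) :
    ρ.avgProj K₂ (ρ.avgProj K₁ v) = ρ.avgProj (K₁ ⊔ K₂) v :=
  avgProj_avgProj_eq_avgProj_sup' hK₁ hK₂ (Subgroup.coe_mul_of_left_le_normalizer_right K₁ K₂ hle) hv

/-- **(ii) COMMUTATION `e_{K₁} e_{K₂} = e_{K₂} e_{K₁}` for compact `K₁ ≤ N(K₂)`, `K₂`**, on smooth vectors. [cite: SchneiderStuhler1997, Ch. II §3 p. 123] -/
theorem avgProj_avgProj_comm_of_le_normalizer {K₁ K₂ : Subgroup G} (hK₁ : IsCompact (K₁ : Set G)) (hK₂ : IsCompact (K₂ : Set G))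
    (hle : K₁ ≤ Subgroup.normalizer (K₂ : Set G)) {v : V} (hv : ρ.IsSmoothVector v) :
    ρ.avgProj K₁ (ρ.avgProj K₂ v) = ρ.avgProj K₂ (ρ.avgProj K₁ v) :=
  avgProj_avgProj_comm_of_coe_sup_eq_mul hK₁ hK₂ (Subgroup.coe_mul_of_left_le_normalizer_right K₁ K₂ hle) hv

/-- **(iii) `e_{K₁ ⊔ K₂} v ∈ V^{K₁} ⊓ V^{K₂}`** for compact `K₁ ≤ N(K₂)`, `K₂` and `v` smooth (the right-hand side is `V^{K₁ ⊔ K₂}` by ★ row 28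
`Literature.NumberTheory.Automorphic.fixedPoints_sup`). [cite: SchneiderStuhler1997, Ch. II §3 p. 123] -/
theorem avgProj_sup_mem_fixedPoints_inf {K₁ K₂ : Subgroup G} (hK₁ : IsCompact (K₁ : Set G)) (hK₂ : IsCompact (K₂ : Set G))
    (hle : K₁ ≤ Subgroup.normalizer (K₂ : Set G)) {v : V} (hv : ρ.IsSmoothVector v) :
    ρ.avgProj (K₁ ⊔ K₂) v ∈ ρ.fixedPoints K₁ ⊓ ρ.fixedPoints K₂ := by
  have h := avgProj_mem_fixedPoints (isCompact_coe_sup_of_le_normalizer hK₁ hK₂ hle) hv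
  exact Submodule.mem_inf.2 ⟨ρ.fixedPoints_antitone le_sup_left h, ρ.fixedPoints_antitone le_sup_right h⟩

/-- **(iii′) `e_{K₁} (e_{K₂} v) ∈ V^{K₁} ⊓ V^{K₂}`** for compact `K₁ ≤ N(K₂)`, `K₂` and `v` smooth. [cite: SchneiderStuhler1997, Ch. II §3 p. 123] -/
theorem avgProj_avgProj_mem_fixedPoints_inf {K₁ K₂ : Subgroup G} (hK₁ : IsCompact (K₁ : Set G)) (hK₂ : IsCompact (K₂ : Set G))
    (hle : K₁ ≤ Subgroup.normalizer (K₂ : Set G)) {v : V} (hv : ρ.IsSmoothVector v) :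
    ρ.avgProj K₁ (ρ.avgProj K₂ v) ∈ ρ.fixedPoints K₁ ⊓ ρ.fixedPoints K₂ := by
  rw [avgProj_avgProj_eq_avgProj_sup_of_le_normalizer hK₁ hK₂ hle hv]
  exact avgProj_sup_mem_fixedPoints_inf hK₁ hK₂ hle hv

/-! ## §4 The geodesic collapse `e_x e_y w = e_x w` for `U_y ⊆ U_x U_z`, `w ∈ V^{U_z}` -/

/-- **THE GEODESIC COLLAPSE `e_{Kx} (e_{Ky} w) = e_{Kx} w`** for `↑Ky ⊆ ↑Kx * ↑Kz` (as sets; `Kx, Ky` compact) and `w ∈ V^{Kz}` smooth: every `ρ(r) w` with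
`r = a b ∈ Ky`, `a ∈ Kx`, `b ∈ Kz`, equals `ρ(a) w`, which `e_{Kx}` sends to `e_{Kx} w`.  This is the (U7)-driven identity (`U_y ⊆ U_x U_z` for `y` on the
geodesic `[x, z]`) on which the Schneider–Stuhler contraction runs. [cite: SchneiderStuhler1997, Prop. I.3.2 pp. 118–119; Ch. II §3 p. 123] [cite: Korman2004, §3.6 (U7)] [cite: BernsteinZelevinsky1976, §2.3] -/
theorem avgProj_avgProj_eq_avgProj_of_subset_mul {Kx Ky Kz : Subgroup G} (hKx : IsCompact (Kx : Set G)) (hKy : IsCompact (Ky : Set G))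
    (hsub : (Ky : Set G) ⊆ (Kx : Set G) * (Kz : Set G)) {w : V} (hw : ρ.IsSmoothVector w) (hwz : w ∈ ρ.fixedPoints Kz) :
    ρ.avgProj Kx (ρ.avgProj Ky w) = ρ.avgProj Kx w := by
  obtain ⟨R, hR⟩ := exists_isLeftTransversal (B := Ky) hKy hw
  have hstab : ∀ s ∈ ρ.stabilizerSubgroup w, ρ s w = w := fun s hs => (ρ.mem_stabilizerSubgroup w s).1 hs
  have hwz' : ∀ b ∈ Kz, ρ b w = w := (ρ.mem_fixedPoints Kz w).1 hwz
  rw [avgProj_eq hKy hw hstab hR, avgProj_inv_card_smul_sum hKx R hw]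
  have : ∑ r ∈ R, ρ.avgProj Kx (ρ r w) = R.card • ρ.avgProj Kx w := by
    rw [← Finset.sum_const]
    refine Finset.sum_congr rfl fun r hr => ?_
    obtain ⟨a, ha, b, hb, hab⟩ := Set.mem_mul.1 (hsub (hR.mem_of_mem r hr))
    rw [← hab, map_mul, Module.End.mul_apply, hwz' b hb, avgProj_apply_of_mem hKx hw ha]
  rw [this, ← Nat.cast_smul_eq_nsmul k, smul_smul,
    inv_mul_cancel₀ (Nat.cast_ne_zero.2 (Finset.card_ne_zero.2 hR.nonempty)), one_smul]

end Representation
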